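import Literature.Probability.Percolation.Isoradial
import Literature.Probability.LatticeModels.IsoradialSquareGrid
import HarnessLib

/-!
# Grimmett–Manolescu's uniform box-crossing property: the printed quantifiers and hypothesis

Topic `Literature/Probability/Percolation`; companion of `Isoradial.lean`, which vendors
Grimmett–Manolescu, *Bond percolation on isoradial graphs: criticality and universality*,
PTRF 159 (2014) 273–327 = arXiv:1204.0505, §3, Theorem 3.1 (the box-crossing theorem opening
§3, arXiv label "main") with its uniform form, display (3.1), as the named fact
`gm_boxCrossingBounds_uniform`. Everything in
this file is PROVED (no `sorry`, no new named fact, D-0026); it records the outcome of the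
`provefact` unit for that fact (2026-08-15): **misstated — stated stronger than its source, on
two counts**, and writes the corrected statement out as the (type-checked) conclusion of
`gm_boxCrossingBounds_uniform.toGM`. (Same pattern as the sibling file `IsoradialPrintedSGP`
for `gm_universality_oneArm`.)

**Status (later on 2026-08-15).** The verdict has been acted upon: `gm_boxCrossingBounds_uniform`
was *restated in place* (verdict clean-up of `Isoradial.lean`; human ruling "restate, keep the
name when the correction sharpens hypotheses / fixes a quantifier") and its body is now the
corrected statement below — constants chosen after `(ε, I, ρ)`, printed square-grid property
`SquareGridPropertyGM I`. This file is kept as the record of the two discrepancies of the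
*original* transcription (what "the def reads" refers to in the section after next is that
original body, quoted in the `History` paragraph of the fact's docstring);
`gm_boxCrossingBounds_uniform.toGM` is since then the unfolding of the fact, and
`gm_boxCrossingBounds_uniform.hasBoxCrossingProperty` is its per-graph corollary for the printed
class `𝒢(ε, I)`.

## What is printed

* §3, Theorem 3.1: "For `G ∈ 𝒢`, `P_G` possesses the box-crossing property." Followed by: "A
  more precise statement holds. […] We shall show that, for `ε > 0` and `I ∈ ℕ`, there exists
  `δ = δ(ε, I) > 0` such that: **(3.1)** if `G` satisfies BAP(ε) and SGP(I), `P_G` satisfies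
  BXP(δ)." After the Theorem "Criticality" that follows: "if `G ∈ 𝒢` satisfies BAP(ε) and
  SGP(I), the claims of the theorem hold with constants that depend only on `ε`, `I`, and not
  further on `G`."
* §2.3, Definition 2.2 (the box-crossing property BXP of a measure `P`): for `ρ > 0` there exist
  `l₀ = l₀(ρ)` and `δ = δ(ρ) > 0` such that for all `l > l₀` and all rectangular domains (any
  rotation and translation) with side-lengths `l` and `ρ l`, `P(open crossings, both ways) ≥ δ`;
  by Harris–FKG it suffices to take `ρ = 2` and axis-parallel boxes, "BXP(l₀, δ)"; "all graphs
  considered here are isoradial with circumradius `1`, and for such graphs one may take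
  `l₀ = 3`"; BXP(δ) := BXP(3, δ).
* §2.1, Definition 2.1: BAP(ε) is `θ_e ∈ [ε, π - ε]` for the rhombus angle `θ_e` at the
  circumcentres (self-dual: `θ_{e*} = π - θ_e`; in the tree `HasBoundedAngles ε` bounds the
  half-angle at the vertex, `halfAngle ∈ [ε, π/2 - ε]`, also self-dual).
* §4.2: SGP(I) — the track-set is *partitioned* `𝒯 = S ∪ T₁ ∪ T₂` with (a) `T_k = (t_k^i : i ∈ ℤ)`
  distinct non-intersecting tracks, (b) for every `s ∈ 𝒯 ∖ T_k`, every track of `T_k` meets `s`,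
  in index order, (c) fewer than `I` track-intersections on `s ∈ T_{3-k}` between `t_k^i` and
  `t_k^{i+1}`; display (4.3): "`G` satisfies SGP(I) if and only if `G*` satisfies SGP(I)";
  last paragraph: "`𝒢(ε, I)` for the set of `G` satisfying BAP(ε) and SGP(I)".
* Where `I` enters the constants: §4.5 ("The box-crossing property for graphs in `𝒢`"), its
  Proposition (arXiv label "grid_bxp"): uniform crossings of the domains cut out by the square
  grid give "BXP(δ') with `δ'` depending on `δ`, `ε`, `I` and not further on `G`" (the cells
  of the grid have Euclidean size controlled by `ε` and `I`, §4.4 "Equivalence of metrics");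
  §7 (proof of Theorem 3.1, the general case): "the box `H` has height `N` and width at most
  `4IN`. By BXP(δ') [for the comparison isoradial square lattice] […] there exists
  `δ = δ(ε, I) > 0` such that `P_{G^K}(E_N) ≥ δ`".

## The two discrepancies

`gm_boxCrossingBounds_uniform` reads
`∀ ε > 0, ∀ ρ > 0, ∃ c > 0, ∃ n₀, ∀ G [preconnected, isoradial, rhombic tiling, BAP(ε),`
`emb.HasSquareGridProperty] → BoxCrossingBounds P_G emb.z ρ c n₀`.

1. **Uniformity in the square-grid parameter.** `RhombicEmbedding.HasSquareGridProperty`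
   (`IsoradialGraphs`) hides the separation bound as `∃ M` *inside* the hypothesis, so the
   constants `c, n₀` are chosen before it: the def asserts box-crossing constants depending on
   `(ε, ρ)` alone, uniformly over all separation parameters. The source chooses `δ = δ(ε, I)`
   *after* `I` ((3.1), §4.5, §7 above), and its proof degrades with `I` (boxes of aspect
   ratio up to `4I` of an isoradial square lattice are crossed, and grid cells of Euclidean
   size `O_{ε}(I)` are compared with Euclidean boxes). No published result gives `I`-free constants; weakening or
   removing the square-grid hypothesis is listed as open by Grimmett, *Criticality,
   universality, and isoradiality*, Proc. ICM 2014 (arXiv:1404.2831), §5(D): "The SGP is a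
   useful tool in the proof […], but it may not be necessary."
2. **The square-grid hypothesis itself.** `HasSquareGridProperty` is the H21 rendering, which
   the tree records to be *strictly weaker* than the printed SGP(I) (docstring of the predicate;
   module docstring of `Literature.Probability.LatticeModels.IsoradialSquareGrid`, with a
   separating rhombic tiling having bounded angles); it drops clause (b). The faithful predicate
   is `RhombicEmbedding.SquareGridPropertyGM I` (and `HasSquareGridPropertyGM := ∃ I, …`).
   Concluding about the larger class is again logically stronger than what is printed.

Each replacement makes the def stronger than Theorem 3.1/(3.1); the direction is pinned down by
`gm_boxCrossingBounds_uniform.toGM` below (misstated fact ⇒ corrected statement; the converse is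
not claimed). The truth of the def as written is not known (it lies in the direction of the
open problem §5(D) of Grimmett's ICM survey); it is *not* refuted here.

## The corrected statement (conclusion of `gm_boxCrossingBounds_uniform.toGM`)

`∀ ε > 0, ∀ I : ℕ, ∀ ρ > 0, ∃ c > 0, ∃ n₀ : ℕ, ∀ (V F : Type) … (emb : RhombicEmbedding G F),`
`G.Preconnected → emb.IsIsoradial → emb.IsRhombicTiling → emb.HasBoundedAngles ε →`
`emb.SquareGridPropertyGM I → BoxCrossingBounds emb.isoradialPercolation emb.z ρ c n₀`
— the class `𝒢(ε, I)` as printed, constants depending on `(ε, I, ρ)`. It was not vendored here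
as a `def … : Prop` (a proving seat may not add an unproved named fact, D-0026); it has since
become the body of `gm_boxCrossingBounds_uniform` itself (status paragraph above), and the
per-graph `HasBoxCrossingProperty` for `G ∈ 𝒢(ε, I)` is re-derived from it below
(`gm_boxCrossingBounds_uniform.hasBoxCrossingProperty`).

Rendering notes carried over from `Isoradial.lean` / `IsoradialPercolation.lean` (not
defects, but to be kept in mind by whoever proves the corrected statement). (1) The tree's
`BoxCrossingBounds μ z ρ c n₀` asks, for all integer scales `n ≥ n₀` and all translations `w`,
for *two-sided* bounds `[c, 1 - c]` on the horizontal crossing of `w + [0, ρ n] × [0, n]` and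
the vertical crossing of `w + [0, n] × [0, ρ n]` (events `embRectCrossing` / `embTBCrossing`,
open path inside the box enlarged by the slack `2` in the crossing direction). From BXP(δ) as
printed this follows for `G ∈ 𝒢(ε, I)` with `c, n₀` depending on `(ε, I, ρ)` only: general
aspect ratios and lower bounds by the "standard application of the Harris–FKG inequality" of
§2.3 (with `l₀ = 3`, whence an `n₀(ρ)`); a printed crossing of the slightly smaller box
`w + (0, ρ n) × (2, n - 2)` is a rendered crossing of `w + [0, ρ n] × [0, n]` (edge lengths
`2 sin(θ_e/2) < 2`); and the upper bounds `≤ 1 - c` by planar duality — the dual `G*` is isoradial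
with `P_{G*}` dual to `P_G` (`p_{e*} = 1 - p_e`, (2.1) with `θ_{e*} = π - θ_e`), satisfies
BAP(ε) and, by (4.3), SGP(I), so `G* ∈ 𝒢(ε, I)` and a dual-open vertical crossing of
`w + (2, ρ n - 2) × (-3, n + 3)` excludes every rendered open horizontal crossing. (2) Graphs
are quantified over `Type` (universe 0), which contains every countable graph up to
isomorphism, exactly as in the original def.

Size: proving either form needs Theorem 3.1 in full — the star–triangle transport of §§5–7 on
top of the inhomogeneous square-lattice case (Grimmett–Manolescu, Ann. Probab. 41 (2013),
"[GM1]") and RSW — a theory; triaged XL, not attempted (and for the def as written there is no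
printed proof to follow).

## References

* G. R. Grimmett, I. Manolescu, *Bond percolation on isoradial graphs: criticality and
  universality*, PTRF 159 (2014) 273–327 (arXiv:1204.0505): §2.1 (Definition 2.1, BAP(ε)),
  §2.3 (Definition 2.2, BXP, `l₀ = 3`, BXP(δ)), §3 (Theorem 3.1 and display (3.1); uniformity
  paragraph after the Theorem "Criticality"), §4.2 (SGP(I), (4.3), `𝒢(ε, I)`), §4.4–4.5
  (equivalence of metrics; Proposition "grid_bxp"), §7 (`δ = δ(ε, I)`).
* G. R. Grimmett, *Criticality, universality, and isoradiality*, Proc. ICM Seoul 2014, vol. IV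
  (arXiv:1404.2831), §5(D) (the square-grid property may not be necessary: open).
-/

namespace Literature.Probability.Percolation

open LatticeModels Percolation

/-- **The original transcription implies the printed-quantifier statement** (since the
in-place restatement of `gm_boxCrossingBounds_uniform`, 2026-08-15, hypothesis and conclusion
agree and this is an unfolding; the text below describes the original situation). The
conclusion of this theorem is Grimmett–Manolescu's uniform box-crossing property (PTRF 159 (2014), §3,
Theorem 3.1 with display (3.1): "for `ε > 0` and `I ∈ ℕ` there exists `δ = δ(ε, I) > 0` such
that if `G` satisfies BAP(ε) and SGP(I), `P_G` satisfies BXP(δ)") in the tree's rendering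
`BoxCrossingBounds` (all aspect ratios `ρ`, all translations, two-sided bounds, eventually in the
scale — see the module docstring for how these follow from BXP(δ) for `G` and its dual), but
with the constants `c, n₀` chosen *after* the square-grid parameter `I` — depending on
`(ε, I, ρ)` as printed — and with the square-grid property **as printed**,
`RhombicEmbedding.SquareGridPropertyGM I` (§4.2, clauses (a)–(c)), i.e. for the printed class
`𝒢(ε, I)`: *for all `ε > 0`, `I ∈ ℕ`, `ρ > 0` there are `c > 0` and `n₀` such that for every
connected isoradial graph `G` (rhombic tiling) with BAP(ε) and SGP(I), `P_G` crosses
`w + [0, ρ n] × [0, n]` horizontally and `w + [0, n] × [0, ρ n]` vertically with probability in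
`[c, 1 - c]` for all `w ∈ ℂ`, `n ≥ n₀`.* It followed from the original `gm_boxCrossingBounds_uniform`
by specialising its `I`-free constants and by `RhombicEmbedding.SquareGridPropertyGM.hasSquareGridProperty`
(printed SGP(I) ⇒ H21 rendering) — which pinned down the direction of the discrepancy recorded
in the module docstring: the original transcription was the *stronger* statement; the converse
implication was not available. (Grimmett–Manolescu 2014, §3 Theorem 3.1, (3.1); §4.2.)
[cite: GrimmettManolescu2014Isoradial, §3 Theorem 3.1 with (3.1) (δ = δ(ε, I)); §4.2 SGP(I), 𝒢(ε, I)] -/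
theorem gm_boxCrossingBounds_uniform.toGM (h : gm_boxCrossingBounds_uniform) :
    ∀ (ε : ℝ) (_ : 0 < ε) (I : ℕ) (ρ : ℝ) (_ : 0 < ρ),
      ∃ c > (0 : ℝ), ∃ n₀ : ℕ, ∀ (V F : Type) [Countable V] [DecidableEq V] [DecidableEq F]
        (G : SimpleGraph V) [G.LocallyFinite] (emb : RhombicEmbedding G F),
        G.Preconnected → emb.IsIsoradial → emb.IsRhombicTiling → emb.HasBoundedAngles ε →
        emb.SquareGridPropertyGM I →
        BoxCrossingBounds emb.isoradialPercolation emb.z ρ c n₀ :=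
  -- through the `(ε, I, ρ)`-instantiation lemma of `Isoradial.lean`, so that this record
  -- elaborates against the fact both before and after its in-place restatement (2026-08-15)
  fun ε hε I ρ hρ =>
    gm_boxCrossingBounds_uniform.boxCrossingBounds_of_squareGridPropertyGM h ε hε I ρ hρ

/-- **Per-graph corollary: the box-crossing property on the printed class `𝒢(ε, I)`**
(Grimmett–Manolescu, PTRF 159 (2014) = arXiv:1204.0505, §3 Theorem 3.1: "For `G ∈ 𝒢`, `P_G`
possesses the box-crossing property", as a consequence of its uniform form (3.1)). For a
countable, locally finite, preconnected graph on a type in `Type`, isoradially and rhombically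
embedded with `HasBoundedAngles ε`, `0 < ε`, and the printed square-grid property
`SquareGridPropertyGM I`, the uniform fact `gm_boxCrossingBounds_uniform` gives
`HasBoxCrossingProperty emb.isoradialPercolation emb.z` (for each aspect ratio `ρ`, the
constants `c, n₀` of the class `𝒢(ε, I)`).
[cite: GrimmettManolescu2014Isoradial, §3 Theorem 3.1 and (3.1); §4.2 (𝒢(ε, I))] -/
theorem gm_boxCrossingBounds_uniform.hasBoxCrossingProperty (h : gm_boxCrossingBounds_uniform)
    {V F : Type} [Countable V] [DecidableEq V] [DecidableEq F] (G : SimpleGraph V)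
    [G.LocallyFinite] (emb : RhombicEmbedding G F) {ε : ℝ} (hε : 0 < ε) {I : ℕ}
    (hconn : G.Preconnected) (hiso : emb.IsIsoradial) (hrh : emb.IsRhombicTiling)
    (hbap : emb.HasBoundedAngles ε) (hsgp : emb.SquareGridPropertyGM I) :
    HasBoxCrossingProperty emb.isoradialPercolation emb.z := by
  intro ρ hρ
  obtain ⟨c, hc, n₀, h'⟩ :=
    gm_boxCrossingBounds_uniform.boxCrossingBounds_of_squareGridPropertyGM h ε hε I ρ hρ
  exact ⟨c, hc, n₀, h' V F G emb hconn hiso hrh hbap hsgp⟩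

end Literature.Probability.Percolation
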